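import Literature.Topology.FourManifolds.BasinTop
import HarnessLib

/-!
# The basin setting: the level conjugation of a boundary map along the trajectories

Topic `Literature/Topology/FourManifolds`; fifth file of the endgame of the Torelli half of
Griffiths' handlebody theorem.  Everything here is **proved**.

For `B : BasinSetting g ξ` and a self-map `χ` of `∂W` preserving the traces:
* `BasinSetting.dom` — the open set of points below `hi` whose trajectory meets `L` in the basin;
* `BasinSetting.conj χ` — **the level conjugation**: `x ↦` the point of level `g x` on the
  trajectory of `transport χ (top x)`.  It preserves levels (`apply_conj`), its top is the
  transported top (`top_conj`), it maps the domain to itself, the conjugation of a left inverse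
  inverts it (`conj_conj_of_leftInverse`), it fixes the points whose top has a fixed boundary
  point (`conj_eq_self`), and for smooth `χ` it is smooth on the domain (`contMDiffAt_conj`:
  the top and the transport are smooth, and the level point is jointly smooth in the point of
  `L` and the level, `SlabFlow.contMDiffAt_levelPoint_prod` of `SlabHittingTime.lean`).

## References

* J. Milnor, *Lectures on the h-cobordism theorem*, notes by L. Siebenmann and J. Sondow,
  Princeton Mathematical Notes (1965): Def. 3.1, proof of Thm. 3.4 (PDF pp. 11–13), Def. 3.9
  (PDF p. 16), Thm. 4.1 (PDF p. 22), proof of Thm. 5.4, Assertion 4 (PDF p. 29).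
  [MilnorHCobordism1965]
* J. Milnor, *Morse theory* (1963), Thm. 3.1 and proof of Thm. 4.1 (p. 25). [Milnor1963]
* H. B. Griffiths, *Automorphisms of a 3-dimensional handlebody*, Abh. Math. Sem. Univ. Hamburg
  26 (1964), §§3–6. [GriffithsHB1964Handlebody]
-/

open scoped Manifold ContDiff Topology
open Set Function Filter Metric

noncomputable section

namespace Literature.Topology.FourManifolds

open Cobordism FourManifolds.Flow

universe u

variable {n : ℕ} {W : Type u} [TopologicalSpace W] [T2Space W] [SecondCountableTopology W]
  [CompactSpace W] [ChartedSpace (EuclideanHalfSpace (n + 1)) W] [IsManifold (𝓡∂ (n + 1)) ∞ W]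

/-! ### The level conjugation of a boundary map along the trajectories -/

namespace BasinSetting

variable {g : W → ℝ} {ξ : Π x : W, TangentSpace (𝓡∂ (n + 1)) x} (B : BasinSetting g ξ)

/-- **The domain of the level conjugation**: the points below `hi` whose trajectory meets the
level `L` at a point of the basin (i.e. the basin minus `p₀` and minus the trajectories going to
the other critical points, below `hi`). [cite: MilnorHCobordism1965, Thm. 4.1 (PDF p. 22)] -/
def dom : Set W := {x | g x < B.hi ∧ Hits B.θ g B.L x ∧ B.top x ∈ B.basin}

/-- Unfolding `dom`. [folklore] -/
theorem mem_dom_iff (x : W) : x ∈ B.dom ↔ g x < B.hi ∧ Hits B.θ g B.L x ∧ B.top x ∈ B.basin := Iff.rfl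

variable {B}

/-- A point of the domain lies in the basin. [folklore] -/
theorem mem_basin_of_mem_dom {x : W} (hx : x ∈ B.dom) : x ∈ B.basin :=
  (B.top_mem_basin_iff hx.1.le hx.2.1).1 hx.2.2

/-- A point of the domain is not `p₀` (its trajectory meets `L`, that of `p₀` is constant). [folklore] -/
theorem ne_p₀_of_mem_dom {x : W} (hx : x ∈ B.dom) : x ≠ B.p₀ := by
  rintro rfl
  obtain ⟨t, ht⟩ := hx.2.1
  rw [B.θ_eq_self_of_isMCriticalPt B.isMCriticalPt_p₀] at ht
  exact absurd (B.apply_lt_L_of_isMCriticalPt B.isMCriticalPt_p₀) (by rw [ht]; exact lt_irrefl _)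

/-- The level of a point of the domain lies in `(g p₀, hi)`. [folklore] -/
theorem apply_mem_Ioo_of_mem_dom {x : W} (hx : x ∈ B.dom) : g x ∈ Ioo (g B.p₀) B.hi :=
  ⟨B.apply_p₀_lt (ne_p₀_of_mem_dom hx), hx.1⟩

/-- The level of a point of the domain is `< 1`. [folklore] -/
theorem apply_lt_one_of_mem_dom {x : W} (hx : x ∈ B.dom) : g x < 1 := hx.1.trans B.hi_lt_one

/-- The top of a point of the domain lies on `L`. [folklore] -/
theorem apply_top_of_mem_dom {x : W} (hx : x ∈ B.dom) : g (B.top x) = B.L := B.apply_top hx.2.1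

variable (B)

/-- **Points of `L ∩ basin` below... every point of `[L, hi)` whose top is in the basin belongs to
the domain**; in particular the points of `L ∩ basin`. [folklore] -/
theorem mem_dom_of_apply_eq_L {w : W} (hw : w ∈ B.basin) (hwL : g w = B.L) : w ∈ B.dom :=
  ⟨by rw [hwL]; exact B.L_lt_hi, hits_of_apply_eq (B.θ_zero w) hwL, by rwa [B.top_of_apply_eq hwL]⟩

/-- **Level points of basin trajectories through `L` belong to the domain.** [folklore] -/
theorem levelProj_mem_dom {w : W} (hw : w ∈ B.basin) (hwL : g w = B.L) {ℓ : ℝ}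
    (hℓ : ℓ ∈ Ioo (g B.p₀) B.hi) : levelProj B.θ g ℓ w ∈ B.dom :=
  ⟨by rw [B.apply_levelProj_of_mem_basin hw hwL hℓ]; exact hℓ.2, B.hits_L_levelProj hwL ℓ,
    by rw [B.top_levelProj hwL]; exact hw⟩

/-- **The domain is open.** [cite: MilnorHCobordism1965, Thm. 4.1 (PDF p. 22)] -/
theorem isOpen_dom : IsOpen B.dom := by
  rw [isOpen_iff_mem_nhds]
  intro x hx
  have h1 : {z : W | g z < B.hi} ∈ 𝓝 x :=
    (isOpen_lt B.isMorseFunction.isMorse.contMDiff.continuous continuous_const).mem_nhds hx.1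
  have h2 : {z : W | Hits B.θ g B.L z} ∈ 𝓝 x := B.hits_L_mem_nhds (apply_lt_one_of_mem_dom hx) hx.2.1
  have h3 : {z : W | B.top z ∈ B.basin} ∈ 𝓝 x :=
    (B.contMDiffAt_top (apply_lt_one_of_mem_dom hx) hx.2.1).continuousAt.preimage_mem_nhds
      (B.isOpen_basin.mem_nhds hx.2.2)
  filter_upwards [h1, h2, h3] with z hz1 hz2 hz3
  exact ⟨hz1, hz2, hz3⟩

section Conj

variable [Nonempty (BoundaryManifold.boundaryData n W).carrier]

/-- **The level conjugation** of a self-map `χ` of `∂W` along the trajectories: a point `x` of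
the domain is sent to the point OF THE SAME LEVEL `g x` on the trajectory through the
transport `transport χ (top x) ∈ L` of its top.  (Junk off the domain.)
[cite: GriffithsHB1964Handlebody, §§3–6] [cite: MilnorHCobordism1965, Thm. 4.1 (PDF p. 22)] -/
def conj (χ : (𝓡∂ (n + 1)).boundary W → (𝓡∂ (n + 1)).boundary W) (x : W) : W :=
  levelProj B.θ g (g x) (B.transport χ (B.top x))

/-- Unfolding `conj`. [folklore] -/
theorem conj_def (χ : (𝓡∂ (n + 1)).boundary W → (𝓡∂ (n + 1)).boundary W) (x : W) :
    B.conj χ x = levelProj B.θ g (g x) (B.transport χ (B.top x)) := rfl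

variable {B}
variable {χ χ' : (𝓡∂ (n + 1)).boundary W → (𝓡∂ (n + 1)).boundary W}

/-- The transported top of a point of the domain lies in `L ∩ basin`, for `χ` preserving the
traces. [folklore] -/
theorem transport_top_mem_basin (hχ : ∀ y, χ y ∈ B.traces ↔ y ∈ B.traces) {x : W} (hx : x ∈ B.dom) :
    B.transport χ (B.top x) ∈ B.basin :=
  B.transport_mem_basin hχ hx.2.2 (apply_top_of_mem_dom hx)

/-- **The level conjugation preserves the levels.** [cite: GriffithsHB1964Handlebody, §§3–6] -/
theorem apply_conj (hχ : ∀ y, χ y ∈ B.traces ↔ y ∈ B.traces) {x : W} (hx : x ∈ B.dom) :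
    g (B.conj χ x) = g x :=
  B.apply_levelProj_of_mem_basin (transport_top_mem_basin hχ hx) (B.apply_transport χ _)
    (apply_mem_Ioo_of_mem_dom hx)

/-- **The top of the conjugate is the transport of the top.** [folklore] -/
theorem top_conj {x : W} (hx : x ∈ B.dom) : B.top (B.conj χ x) = B.transport χ (B.top x) := by
  have _ := hx
  exact B.top_levelProj (B.apply_transport χ _) _

/-- **The level conjugation maps the domain to itself.** [folklore] -/
theorem conj_mem_dom (hχ : ∀ y, χ y ∈ B.traces ↔ y ∈ B.traces) {x : W} (hx : x ∈ B.dom) :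
    B.conj χ x ∈ B.dom :=
  B.levelProj_mem_dom (transport_top_mem_basin hχ hx) (B.apply_transport χ _) (apply_mem_Ioo_of_mem_dom hx)

/-- **The level conjugation of `χ'` inverts that of `χ` when `χ' ∘ χ = id`** (on the domain,
both preserving the traces). [cite: GriffithsHB1964Handlebody, §§3–6] -/
theorem conj_conj_of_leftInverse (h : LeftInverse χ' χ) (hχ : ∀ y, χ y ∈ B.traces ↔ y ∈ B.traces)
    {x : W} (hx : x ∈ B.dom) : B.conj χ' (B.conj χ x) = x := by
  rw [conj_def, top_conj hx, apply_conj hχ hx, B.transport_leftInverse h (apply_top_of_mem_dom hx)]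
  exact B.levelProj_top_self hx.2.1 (apply_mem_Ioo_of_mem_dom hx)

/-- **The level conjugation fixes the points whose top has a fixed boundary point.** [folklore] -/
theorem conj_eq_self {x : W} (hx : x ∈ B.dom) (h : χ (B.bret (B.top x)) = B.bret (B.top x)) :
    B.conj χ x = x := by
  rw [conj_def, B.transport_eq_self (apply_top_of_mem_dom hx) h]
  exact B.levelProj_top_self hx.2.1 (apply_mem_Ioo_of_mem_dom hx)

/-- The conjugate of a point of the domain lies in the basin. [folklore] -/
theorem conj_mem_basin (hχ : ∀ y, χ y ∈ B.traces ↔ y ∈ B.traces) {x : W} (hx : x ∈ B.dom) :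
    B.conj χ x ∈ B.basin :=
  mem_basin_of_mem_dom (conj_mem_dom hχ hx)

end Conj

/-! #### Smoothness -/

section Smooth

/-- **The retraction is smooth at the points of depth `< a'`.** [cite: MilnorHCobordism1965, proof of Thm. 3.4 (PDF pp. 12–13)] -/
theorem contMDiffAt_ret {w : W} (hw : B.depth w < B.S.a') : ContMDiffAt (𝓡∂ (n + 1)) (𝓡∂ (n + 1)) ∞ B.ret w := by
  have hwa : B.depth w < B.S.Γ.a := hw.trans B.S.a'_lt
  obtain ⟨y, hy, hwd⟩ := B.S.Γ.cover w hwa.le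
  have h := B.S.Γ.contMDiffOn_ret y hy
  have hO : IsOpen ((B.S.Γ.bx y hy).dom ∩ {z : W | B.depth z < B.S.Γ.a}) :=
    (B.S.Γ.bx y hy).isOpen_dom.inter (isOpen_lt B.S.D.f_smooth.continuous continuous_const)
  exact h.contMDiffAt (hO.mem_nhds ⟨hwd, hwa⟩)

/-- The depth of a point of `L` is `κ < a'`. [folklore] -/
theorem depth_lt_of_apply_eq_L {w : W} (hw : g w = B.L) : B.depth w < B.S.a' := by
  rw [B.depth_eq_of_ge (by rw [hw]; exact B.one_sub_a'_lt_L.le), hw]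
  unfold L; linarith [B.κ_le, B.a'_pos]

variable [Nonempty (BoundaryManifold.boundaryData n W).carrier]

/-- **`bret` is smooth at the points of `L`** (indeed of depth `< a'`): the retraction is, and
the inverse of the boundary inclusion is smooth on the boundary. [folklore] -/
theorem contMDiffAt_bret {w : W} (hw : B.depth w < B.S.a') :
    ContMDiffAt (𝓡∂ (n + 1)) (𝓡 n) ∞ B.bret w := by
  set b := BoundaryManifold.boundaryData n W with hb
  have hs : {z : W | B.depth z < B.S.a'} ∈ 𝓝 w :=
    (isOpen_lt B.S.D.f_smooth.continuous continuous_const).mem_nhds hw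
  have h1 : ContMDiffWithinAt (𝓡∂ (n + 1)) (𝓡∂ (n + 1)) ∞ B.ret {z : W | B.depth z < B.S.a'} w :=
    (B.contMDiffAt_ret hw).contMDiffWithinAt
  have h2 : ContMDiffWithinAt (𝓡∂ (n + 1)) (𝓡 n) ∞ b.inclInv (range b.incl) (B.ret w) :=
    b.contMDiffOn_inclInv _ (by
      rw [b.range_incl]; exact B.S.Γ.ret_mem_boundary (hw.trans B.S.a'_lt).le)
  have h3 : MapsTo B.ret {z : W | B.depth z < B.S.a'} (range b.incl) := fun z hz => by
    rw [b.range_incl]; exact B.S.Γ.ret_mem_boundary ((show B.depth z < B.S.a' from hz).trans B.S.a'_lt).le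
  exact (h2.comp w h1 h3).contMDiffAt hs

/-- **The transport of a smooth `χ` is smooth at the points of `L`** (of depth `< a'`). [folklore] -/
theorem contMDiffAt_transport {χ : (𝓡∂ (n + 1)).boundary W → (𝓡∂ (n + 1)).boundary W}
    (hχ : ContMDiff (𝓡 n) (𝓡 n) ∞ χ) {w : W} (hw : B.depth w < B.S.a') :
    ContMDiffAt (𝓡∂ (n + 1)) (𝓡∂ (n + 1)) ∞ (B.transport χ) w := by
  have h1 : ContMDiffAt (𝓡∂ (n + 1)) (𝓡∂ (n + 1)) ∞ (fun z => ((χ (B.bret z) : (𝓡∂ (n + 1)).boundary W) : W)) w :=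
    (BoundaryManifold.isSmoothEmbedding_subtype_val (n := n) (W := W)).contMDiff.contMDiffAt.comp w
      (hχ.contMDiffAt.comp w (B.contMDiffAt_bret hw))
  exact B.contMDiff_push.contMDiffAt.comp w h1

/-- **The level conjugation of a smooth `χ` preserving the traces is smooth on the domain.**
[cite: GriffithsHB1964Handlebody, §§3–6] [cite: MilnorHCobordism1965, Thm. 4.1, proof of Thm. 5.4 Assertion 4 (PDF pp. 22, 29)] -/
theorem contMDiffAt_conj {χ : (𝓡∂ (n + 1)).boundary W → (𝓡∂ (n + 1)).boundary W}
    (hχs : ContMDiff (𝓡 n) (𝓡 n) ∞ χ) (hχ : ∀ y, χ y ∈ B.traces ↔ y ∈ B.traces) {x : W}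
    (hx : x ∈ B.dom) : ContMDiffAt (𝓡∂ (n + 1)) (𝓡∂ (n + 1)) ∞ (B.conj χ) x := by
  set w₁ : W := B.transport χ (B.top x) with hw₁
  have hw₁L : g w₁ = B.L := B.apply_transport χ _
  have hw₁b : w₁ ∈ B.basin := transport_top_mem_basin hχ hx
  have hℓ : g x ∈ Ioo B.lo B.hi := ⟨B.lo_lt_apply x, hx.1⟩
  -- the outer map `(w, ℓ) ↦ levelProj ℓ w` at `(w₁, g x)`
  have hout : ContMDiffAt ((𝓡∂ (n + 1)).prod 𝓘(ℝ, ℝ)) (𝓡∂ (n + 1)) ∞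
      (fun p : W × ℝ => B.θ (hittingTime B.θ g p.2 p.1, p.1)) (w₁, g x) :=
    B.slabFlow'.contMDiffAt_levelPoint_prod (by rw [hw₁L]; exact Ioo_subset_Icc_self B.L_mem_Ioo)
      (B.not_isMCriticalPt_of_eq_L hw₁L) hℓ
      (B.hits_of_mem_basin_of_apply_eq_L hw₁b hw₁L (apply_mem_Ioo_of_mem_dom hx))
  -- the inner map `x ↦ (transport χ (top x), g x)`
  have hin : ContMDiffAt (𝓡∂ (n + 1)) ((𝓡∂ (n + 1)).prod 𝓘(ℝ, ℝ)) ∞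
      (fun z : W => (B.transport χ (B.top z), g z)) x := by
    refine ContMDiffAt.prodMk ?_ B.isMorseFunction.isMorse.contMDiff.contMDiffAt
    exact (B.contMDiffAt_transport hχs (B.depth_lt_of_apply_eq_L (apply_top_of_mem_dom hx))).comp x
      (B.contMDiffAt_top (apply_lt_one_of_mem_dom hx) hx.2.1)
  have key : ContMDiffAt (𝓡∂ (n + 1)) (𝓡∂ (n + 1)) ∞
      ((fun p : W × ℝ => B.θ (hittingTime B.θ g p.2 p.1, p.1)) ∘
        (fun z : W => (B.transport χ (B.top z), g z))) x := hout.comp x hin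
  exact key

end Smooth

end BasinSetting

end Literature.Topology.FourManifolds
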